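import Summits.QuantumFields.YangMills.Theorems.UnitScaleTiltProp7SectET3DeltaEtaExplicitT3
import Summits.QuantumFields.YangMills.Theorems.UnitScaleTiltProp7PlaquetteCurlComparison
import Summits.QuantumFields.YangMills.Theorems.UnitScaleTiltProp7RieszTauFrobNormT3
import Summits.QuantumFields.YangMills.Theorems.UnitScaleTiltProp7FlatLocalMinimality
import Summits.QuantumFields.YangMills.Theorems.UnitScaleTiltProp7DeltaPrimeL2Bound
import HarnessLib

/-!
# Route `UnitScaleTilt`, crux K1 «MinimiserStabilityRegPr» (stmt-QuantumFields-19200) — ARCHITECTURE (A′) «HCOW-VIA-Σ» (★★OWNER RULING g28-№13):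
# THE (SLOT) ROW OF THE KNIT DOOR ✓`Prop7HcoWOfSigmaRowsSlots.hcoW_of_sigmaRowsW_slots` AT THE SLOT OF RECORD `Δx := Δ^η` —
# «the Hessian letter is bounded above by the curl form plus an `O(e)` mass term» ([Balaban1985BackgroundPropagators] (3.10): `Δ = D*D + Δ′`),
# from the (3.10) pair (✓`Prop7SectET3DeltaEtaExplicit.symm_DeltaEta_toL2_apply`, the curvature part `Δ′₁` in L²-form currency) and the plaquette/curl comparison
# (✓`Prop7PlaquetteCurlComparison.norm_curl_le_plaqTerm_add`)

Cell `ym3-torus`, width seat `ym3-torus-px5` (gen 4; FILL-TO-CAP «width 5»); E′ namer ★ym-ust-19200-p1 g17 KNIT-INPUT CENSUS 2026-08-29T02:09:26Z «SLOT ⟸ (3.10) pair (★w2∕px5 letters)».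
THEOREMS ONLY (0 `def`, 0 `sorry`); `--supports stmt-QuantumFields-19200 --as helper`; count-neutral.  YM₃ on T³ is ladder rung R3, NOT the Clay problem; nothing here is a
claim about a stub, the crux, `hcoW`, HESS at the critical configuration, d = 4 or the mass gap; nothing of [Balaban1985BackgroundPropagators] §3 is asserted.

THE PRINT.  [Balaban1985BackgroundPropagators] (3.10) p. 392 *«⟨A, ΔA⟩ = ⟨A, D*DA⟩ + ⟨A, Δ′A⟩ … ⟨A, D*DA⟩ = Σ_{p⊂T_η} η^d tr((D A)(p))²»*; [Balaban1985Variational] p. 299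
*«Δ = D*D + Δ′, Δ′ is a local, bounded operator satisfying the bound |Δ′HB|₍₋₃₎ ≦ O(ε₁)|B|»*; (47)–(48) pp. 285–286 (the linearised plaquette variable).

WHAT IS PROVED (member `F`, `n K`, weight `c₀ > 0`; background `W : GaugeField (F.P K) 0 SU(2)`; `T := torusT (F.P K) 0`, `U := fun μ x ↦ bgUnits F K W ⟨x,μ⟩`;
ns `…Theorems.Prop7SlotRowOfDeltaEta`).
* §1 ★★ `re_sum_trace_conjTranspose_mul_covCodiffCurlT` — THE `D*D` PART OF (3.10) IN THE ROUTE'S TRACE PAIRING, FOR ARBITRARY (complex) ONE-FORMS: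
  `re Σ_b tr(X(b)ᴴ·(D¹*_WD¹_W X)(b)) = Σ_{p : Plaq} ‖frobEquiv⁻¹((D¹_W X)(p))‖²` ((3.9) adjointness lit ✓`B9Eq39Adjoint.sum_posPlaq_curl_mul` with `τ := tr`, `A := Xᴴ`,
  unitary background lit ✓`B9Eq310Hermitian.star_curl` ∘ ✓`val_inv_bgUnits_eq_star`; member plaquettes ↔ lit's `posPlaq` by ✓`Prop7SectET3HessFormExplicit.sum_plaq_eq_sum_posPlaq`).
* §1 ★ `re_inner_toL2_DeltaEta_eq` — `re⟪toL2 X, Δ^η_W (toL2 X)⟫ = c₀·η⁻²·(Σ_p ‖frobEquiv⁻¹((D¹_W X)(p))‖² + re Σ_b tr(X(b)ᴴ·(Δ′₁X)(b)))` (print's (3.10) read through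
  ✓`symm_DeltaEta_toL2_apply` + ✓`inner_toL2`).
* §2 ★ `sum_normSq_curl_le_plaqK` (any `P`, level `i`, `SU(N)`): under `dist1(W(∂p)) ≤ a`, `Σ_p ‖curl_p(Z)‖² ≤ 2·Σ_p ‖K^W_p(Z)‖² + 64·d·a²·Σ_b ‖Z b‖²`
  (px15's ✓`norm_curl_le_plaqTerm_add` squared and summed; incidence ✓`Prop7FlatLocalMin.sum_plaq_bonds_le`).
* §3 ★★★ `re_inner_DeltaEta_le_of_deltaPrime_form` — THE (SLOT) ROW AT `Δx := DeltaEta`, NATURAL CONSTANTS: on `RegPr F n K e W`, for every one-form `X` whose curvature pairing obeys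
  `re Σ_b tr(X(b)ᴴ·(Δ′₁X)(b)) ≤ θ′·Σ_b‖X b‖²` (the L²-form currency of «Δ′ is a local, bounded operator»; supplier: ★w4 g8's T2 file, `θ′ = C_Δ′·e·η²`):
  `re⟪toL2 X, Δ^η_W (toL2 X)⟫ ≤ 4·c₀·η⁻²·Σ_p ‖K^W_p(I•X)‖² + c₀·η⁻²·(384·regThreshold² + θ′)·Σ_b‖X b‖²`, the plaquette letter `K^W_p` being the door's, token for token.
* §3 ★★★ `slot_DeltaEta_of_deltaPrime_form` — THE DOOR'S LETTER: for `0 < e`, `∃ cK cE : ℝ` with `re⟪toL2 X, Δ^η_W (toL2 X)⟫ ≤ cK·Σ_p ‖K^W_p(I•X)‖² + cE·e·((L^{K−n})²)⁻¹·Σ_b‖X b‖²`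
  (the (SLOT) conjunct of ✓`hcoW_of_sigmaRowsW_slots` VERBATIM at `X := eta • A`, `Δx F K W := DeltaEtaSlot F n K (c₀ L) W`).
* §4 (v1.1) ★ `re_sum_trace_deltaPrimeOp_le_of_regPr` — the curvature-part form bound DISCHARGED on `RegPr` from ★w4 g8's ✓`Prop7DeltaPrimeL2Bound.norm_sum_trace_conjTranspose_mul_deltaPrimeOp_le`
  (`θ′ := 2058·e·η²`); ★★★ `re_inner_DeltaEta_le_of_regPr`, ★★★ `slot_DeltaEtaSlot_of_regPr` — THE (SLOT) ROW ON `RegPr` WITH NO DISPLAYED HYPOTHESIS (`(cE·e)·η² = c₀·e·(2058 + 384·e·η²)`).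
HONEST SCOPE.  Bookkeeping over landed letters (no analysis): §3 displays the curvature-part form bound in its supplier's currency, §4 discharges it from ✓`Prop7DeltaPrimeL2Bound`; the
constants `cK`, `cE` are per-member reals (they carry `η⁻²`), exactly as the door quantifies them.  Nothing of [B9] Thm 3.11 ∕ positivity ∕ `hcoW` ∕ E′ ∕ EX is proved; nothing continuum ∕
OS ∕ mass-gap ∕ Clay.

References: T. Bałaban, CMP **99** (1985) 389–434 [Balaban1985BackgroundPropagators] ((3.4) p.391, (3.9)–(3.12) p.392); CMP **102** (1985) 277–309 [Balaban1985Variational]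
((19) p.281, (47)–(48) pp.285–286, (141)–(143) p.299); CMP **98** (1985) 17–51 [Balaban1985Averaging] ((20) p.21).
-/

set_option autoImplicit false

noncomputable section

open scoped Matrix.Norms.L2Operator BigOperators InnerProductSpace ComplexConjugate Matrix
open Complex (I)

namespace Summit.QuantumFields.YangMills.Theorems.Prop7SlotRowOfDeltaEta

open Literature.MathematicalPhysics.QuantumFieldTheory.Balaban1983to89
open Literature.MathematicalPhysics.QuantumFieldTheory.Balaban1983to89.T3ContinuumYM3Torus
open Literature.MathematicalPhysics.QuantumFieldTheory.Balaban1983to89.T3PrintedRegularMinimiser (RegPr)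
open Literature.MathematicalPhysics.QuantumFieldTheory.Balaban1983to89.T3RegularMinimiser (regThreshold)
open T3SectALandauChart (formComp bgUnits covCodiffCurlT eta eta_pos)
open B9TorusCalculus (torusT)
open B9Eq39Adjoint (curl divP posPlaq sum_posPlaq_curl_mul curl_smul)
open B9Eq310Hermitian (deltaPrimeOp star_curl)
open B10Eq27TorusAxialLog (unitsField toUField)
open B11Eq103H1Complex (BondL2K)
open Summit.QuantumFields.YangMills.Theorems.Prop7SectET3Transport (periodsT3)
open Summit.QuantumFields.YangMills.Theorems.Prop7SectET3HilbertLetters (W₂ frobEquiv toL2 inner_toL2 inner_frobEquiv_symm)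
open Summit.QuantumFields.YangMills.Theorems.Prop7SectET3WilsonHessian (DeltaEta DeltaEtaSlot DeltaEtaSlot_apply)
open Summit.QuantumFields.YangMills.Theorems.Prop7SectET3DeltaEtaExplicit (symm_DeltaEta_toL2_apply sum_pbond_eq val_inv_bgUnits_eq_star)
open Summit.QuantumFields.YangMills.Theorems.Prop7SectET3HessFormExplicit (sum_plaq_eq_sum_posPlaq)
open Summit.QuantumFields.YangMills.Theorems.Prop7SecondOrderDict (covCodiffCurlT_one_eq)
open Summit.QuantumFields.YangMills.Theorems.Prop7RieszTauFrobNorm (norm_sq_frobEquiv_symm sum_norm_sq_le_two_mul_opNorm_sq)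
open Summit.QuantumFields.YangMills.Theorems.Prop7PlaquetteCurlComparison (norm_curl_le_plaqTerm_add)
open Summit.QuantumFields.YangMills.Theorems.Prop7FlatLocalMin (sum_plaq_bonds_le)

/-! ## §1 The `D*D` part of (3.10) in the route's trace pairing, and the reading of `re⟪X̃, Δ^η X̃⟫` -/

section Member

variable {F : T3Family} {n K : ℕ} {c₀ : ℝ}

/-- The trace on `M₂(ℂ)` is tracial: `tr(ab) = tr(ba)` (for lit's `τ`-hypotheses). [folklore] -/
theorem traceLinearMap_mul_comm (a b : Matrix (Fin 2) (Fin 2) ℂ) :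
    Matrix.traceLinearMap (Fin 2) ℂ ℂ (a * b) = Matrix.traceLinearMap (Fin 2) ℂ ℂ (b * a) := by
  simp only [Matrix.traceLinearMap_apply]
  exact Matrix.trace_mul_comm a b

/-- `re tr(Mᴴ M) = ‖frobEquiv⁻¹ M‖²` (the un-normalised Frobenius norm of the fibre letter `W₂`). [cite: Balaban1985Averaging, (18) p.21] -/
theorem re_trace_conjTranspose_mul_self (M : Matrix (Fin 2) (Fin 2) ℂ) :
    RCLike.re (Matrix.trace (M.conjTranspose * M)) = ‖(frobEquiv.symm M : W₂)‖ ^ 2 := by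
  rw [← inner_frobEquiv_symm, inner_self_eq_norm_sq (𝕜 := ℂ)]

/-- ★★ **THE `D*D` PART OF (3.10) FOR ARBITRARY ONE-FORMS**: `re Σ_b tr(X(b)ᴴ·(D¹*_WD¹_W X)(b)) = Σ_{p : Plaq} ‖frobEquiv⁻¹((D¹_W X)(p))‖²` — (3.9) adjointness with `τ := tr` and
`A := Xᴴ`, then `(D_W Xᴴ)(p) = ((D_W X)(p))ᴴ` on the unitary background. [cite: Balaban1985BackgroundPropagators, (3.9)–(3.10) p.392] -/
theorem re_sum_trace_conjTranspose_mul_covCodiffCurlT (W : GaugeField (F.P K) 0 (Matrix.specialUnitaryGroup (Fin 2) ℂ))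
    (X : PBond (F.P K) 0 → Matrix (Fin 2) (Fin 2) ℂ) :
    RCLike.re (∑ b : PBond (F.P K) 0, Matrix.trace ((X b).conjTranspose * covCodiffCurlT 1 (bgUnits F K W) X b.dir b.src))
      = ∑ p : Plaq (F.P K) 0, ‖(frobEquiv.symm
          (curl (torusT (F.P K) 0) (fun μ x => bgUnits F K W ⟨x, μ⟩) (formComp X) p.μ p.ν p.src) : W₂)‖ ^ 2 := by
  set T := torusT (F.P K) 0 with hT
  set U : Fin (F.P K).d → Site (F.P K) 0 → (Matrix (Fin 2) (Fin 2) ℂ)ˣ := fun μ x => bgUnits F K W ⟨x, μ⟩ with hU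
  have hUu : ∀ μ x, (((U μ x)⁻¹ : (Matrix (Fin 2) (Fin 2) ℂ)ˣ) : Matrix (Fin 2) (Fin 2) ℂ) = star (U μ x : Matrix (Fin 2) (Fin 2) ℂ) :=
    fun μ x => by rw [hU]; exact val_inv_bgUnits_eq_star W μ x
  -- rewrite `D¹*D¹ X` as `divP (curl (formComp X))` and the bond sum as a site/direction sum
  have h1 : ∑ b : PBond (F.P K) 0, Matrix.trace ((X b).conjTranspose * covCodiffCurlT 1 (bgUnits F K W) X b.dir b.src)
      = ∑ x : Site (F.P K) 0, ∑ μ : Fin (F.P K).d,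
          Matrix.traceLinearMap (Fin 2) ℂ ℂ (formComp (star X) μ x * divP T U (curl T U (formComp X)) μ x) := by
    rw [sum_pbond_eq]
    refine Finset.sum_congr rfl fun x _ => Finset.sum_congr rfl fun μ _ => ?_
    rw [Matrix.traceLinearMap_apply, covCodiffCurlT_one_eq]
    rfl
  -- (3.9): `Σ_b τ(A(b)·(D*F)(b)) = Σ_{p} τ((D A)(p)·F(p))` with `A := Xᴴ`, `F := D X`
  have h2 := sum_posPlaq_curl_mul T U (Matrix.traceLinearMap (Fin 2) ℂ ℂ) traceLinearMap_mul_comm (formComp (star X)) (curl T U (formComp X))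
  rw [h1, ← h2, ← sum_plaq_eq_sum_posPlaq (fun x μ ν => Matrix.traceLinearMap (Fin 2) ℂ ℂ (curl T U (formComp (star X)) μ ν x * curl T U (formComp X) μ ν x)),
    map_sum]
  refine Finset.sum_congr rfl fun p _ => ?_
  have hstar : curl T U (formComp (star X)) p.μ p.ν p.src = (curl T U (formComp X) p.μ p.ν p.src).conjTranspose := by
    rw [show formComp (star X) = star (formComp X) from rfl, ← star_curl T U hUu, Matrix.star_eq_conjTranspose]
  rw [Matrix.traceLinearMap_apply, hstar, re_trace_conjTranspose_mul_self]

/-- `re (a·(b·z)) = a·b·re z` for real `a b`. [folklore] -/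
theorem re_ofReal_mul_ofReal_mul (a b : ℝ) (z : ℂ) : RCLike.re ((a : ℂ) * ((b : ℂ) * z)) = a * b * RCLike.re z := by
  simp only [RCLike.re_to_complex, Complex.mul_re, Complex.ofReal_re, Complex.ofReal_im, zero_mul, sub_zero]
  ring

/-- ★ **`Δ^η_W (toL2 X) = toL2 (η⁻² • (D¹*D¹_W X + Δ′₁X))`** — ✓`symm_DeltaEta_toL2_apply` read forwards. [cite: Balaban1985BackgroundPropagators, (3.10) p.392] -/
theorem DeltaEta_toL2_eq_toL2 [Fact (0 < c₀)] (W : GaugeField (F.P K) 0 (Matrix.specialUnitaryGroup (Fin 2) ℂ)) (X : PBond (F.P K) 0 → Matrix (Fin 2) (Fin 2) ℂ) :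
    DeltaEta F n K c₀ W (toL2 F K c₀ X)
      = toL2 F K c₀ (fun b => ((((eta F n K)⁻¹ ^ 2 : ℝ) : ℂ)) •
          (covCodiffCurlT 1 (bgUnits F K W) X b.dir b.src
            + deltaPrimeOp (torusT (F.P K) 0) (fun μ x => bgUnits F K W ⟨x, μ⟩) 1 (formComp X) b.dir b.src)) := by
  rw [← LinearEquiv.symm_apply_eq]
  funext b
  exact symm_DeltaEta_toL2_apply W X b

/-- ★ **PRINT'S (3.10) READ IN `L²`: `re⟪toL2 X, Δ^η_W (toL2 X)⟫ = c₀·η⁻²·(Σ_p ‖frobEquiv⁻¹((D¹_W X)(p))‖² + re Σ_b tr(X(b)ᴴ·(Δ′₁X)(b)))`** — the `D*D` part as a sum of squares, the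
curvature part left in the trace pairing. [cite: Balaban1985BackgroundPropagators, (3.10)–(3.11) p.392] -/
theorem re_inner_toL2_DeltaEta_eq [Fact (0 < c₀)] (W : GaugeField (F.P K) 0 (Matrix.specialUnitaryGroup (Fin 2) ℂ)) (X : PBond (F.P K) 0 → Matrix (Fin 2) (Fin 2) ℂ) :
    RCLike.re ⟪toL2 F K c₀ X, DeltaEta F n K c₀ W (toL2 F K c₀ X)⟫_ℂ
      = c₀ * (eta F n K)⁻¹ ^ 2 *
        (∑ p : Plaq (F.P K) 0, ‖(frobEquiv.symm
            (curl (torusT (F.P K) 0) (fun μ x => bgUnits F K W ⟨x, μ⟩) (formComp X) p.μ p.ν p.src) : W₂)‖ ^ 2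
          + RCLike.re (∑ b : PBond (F.P K) 0, Matrix.trace ((X b).conjTranspose
              * deltaPrimeOp (torusT (F.P K) 0) (fun μ x => bgUnits F K W ⟨x, μ⟩) 1 (formComp X) b.dir b.src))) := by
  rw [DeltaEta_toL2_eq_toL2, inner_toL2, ← re_sum_trace_conjTranspose_mul_covCodiffCurlT W X]
  simp only [smul_add, Matrix.mul_smul, Matrix.trace_add, Matrix.trace_smul, Finset.sum_add_distrib, smul_eq_mul, mul_add, map_add]
  rw [← Finset.mul_sum, ← Finset.mul_sum, re_ofReal_mul_ofReal_mul, re_ofReal_mul_ofReal_mul]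

end Member

/-! ## §2 The B9 curl energy against the door's plaquette energy `Σ_p ‖K^W_p(Z)‖²` -/

section Comparison

variable {P : Params} {N : ℕ} [NeZero N] {i : ℕ}

/-- Real arithmetic: `(k + 2a(u + v))² ≤ 2k² + 16a²(u² + v²)`. [folklore] -/
theorem sq_add_le_aux (k a u v : ℝ) : (k + 2 * a * (u + v)) ^ 2 ≤ 2 * k ^ 2 + 16 * a ^ 2 * (u ^ 2 + v ^ 2) := by
  nlinarith [sq_nonneg (k - 2 * a * (u + v)), sq_nonneg (u - v), sq_nonneg a]

/-- ★ **THE CURL ENERGY AGAINST THE DOOR'S PLAQUETTE ENERGY**: under `dist1(W(∂p)) ≤ a` for all `p`,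
`Σ_p ‖curl_p(Z)‖² ≤ 2·Σ_p ‖K^W_p(Z)‖² + 64·d·a²·Σ_b ‖Z b‖²` (px15's pointwise ✓`norm_curl_le_plaqTerm_add`, squared, summed, incidence `Σ_p Σ_{∂p} ≤ 4d·Σ_b`).
[cite: Balaban1985Variational, (47)-(48) pp.285-286; Balaban1985BackgroundPropagators, (3.4) p.391] -/
theorem sum_normSq_curl_le_plaqK (W : GaugeField P i (Matrix.specialUnitaryGroup (Fin N) ℂ)) {a : ℝ}
    (hU : ∀ p : Plaq P i, dist1 (GaugeField.plaqHol W p) ≤ a) (Z : PBond P i → Matrix (Fin N) (Fin N) ℂ) :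
    ∑ p : Plaq P i, ‖curl (torusT P i) (fun κ z => unitsField (toUField W) ⟨z, κ⟩) (fun κ z => Z ⟨z, κ⟩) p.μ p.ν p.src‖ ^ 2
      ≤ 2 * ∑ p : Plaq P i, ‖(Z ⟨p.src, p.μ⟩
          + ((W ⟨p.src, p.μ⟩ : Matrix (Fin N) (Fin N) ℂ) * Z ⟨p.src.shift p.μ, p.ν⟩ * star (W ⟨p.src, p.μ⟩ : Matrix (Fin N) (Fin N) ℂ))
          - (((W ⟨p.src, p.μ⟩ * W ⟨p.src.shift p.μ, p.ν⟩ * (W ⟨p.src.shift p.ν, p.μ⟩)⁻¹ : Matrix.specialUnitaryGroup (Fin N) ℂ) : Matrix (Fin N) (Fin N) ℂ)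
              * Z ⟨p.src.shift p.ν, p.μ⟩
              * star ((W ⟨p.src, p.μ⟩ * W ⟨p.src.shift p.μ, p.ν⟩ * (W ⟨p.src.shift p.ν, p.μ⟩)⁻¹ : Matrix.specialUnitaryGroup (Fin N) ℂ) : Matrix (Fin N) (Fin N) ℂ))
          - (((GaugeField.plaqHol W p : Matrix.specialUnitaryGroup (Fin N) ℂ) : Matrix (Fin N) (Fin N) ℂ) * Z ⟨p.src, p.ν⟩
              * star ((GaugeField.plaqHol W p : Matrix.specialUnitaryGroup (Fin N) ℂ) : Matrix (Fin N) (Fin N) ℂ)))‖ ^ 2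
        + 64 * P.d * a ^ 2 * ∑ b : PBond P i, ‖Z b‖ ^ 2 := by
  -- pointwise square
  have hpt : ∀ p : Plaq P i,
      ‖curl (torusT P i) (fun κ z => unitsField (toUField W) ⟨z, κ⟩) (fun κ z => Z ⟨z, κ⟩) p.μ p.ν p.src‖ ^ 2
        ≤ 2 * ‖(Z ⟨p.src, p.μ⟩
          + ((W ⟨p.src, p.μ⟩ : Matrix (Fin N) (Fin N) ℂ) * Z ⟨p.src.shift p.μ, p.ν⟩ * star (W ⟨p.src, p.μ⟩ : Matrix (Fin N) (Fin N) ℂ))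
          - (((W ⟨p.src, p.μ⟩ * W ⟨p.src.shift p.μ, p.ν⟩ * (W ⟨p.src.shift p.ν, p.μ⟩)⁻¹ : Matrix.specialUnitaryGroup (Fin N) ℂ) : Matrix (Fin N) (Fin N) ℂ)
              * Z ⟨p.src.shift p.ν, p.μ⟩
              * star ((W ⟨p.src, p.μ⟩ * W ⟨p.src.shift p.μ, p.ν⟩ * (W ⟨p.src.shift p.ν, p.μ⟩)⁻¹ : Matrix.specialUnitaryGroup (Fin N) ℂ) : Matrix (Fin N) (Fin N) ℂ))
          - (((GaugeField.plaqHol W p : Matrix.specialUnitaryGroup (Fin N) ℂ) : Matrix (Fin N) (Fin N) ℂ) * Z ⟨p.src, p.ν⟩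
              * star ((GaugeField.plaqHol W p : Matrix.specialUnitaryGroup (Fin N) ℂ) : Matrix (Fin N) (Fin N) ℂ)))‖ ^ 2
          + 16 * a ^ 2 * (‖Z ⟨p.src.shift p.ν, p.μ⟩‖ ^ 2 + ‖Z ⟨p.src, p.ν⟩‖ ^ 2) := by
    intro p
    have h := norm_curl_le_plaqTerm_add W hU Z p
    have h0 : 0 ≤ ‖curl (torusT P i) (fun κ z => unitsField (toUField W) ⟨z, κ⟩) (fun κ z => Z ⟨z, κ⟩) p.μ p.ν p.src‖ := norm_nonneg _
    exact (pow_le_pow_left₀ h0 h 2).trans (sq_add_le_aux _ _ _ _)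
  refine (Finset.sum_le_sum fun p _ => hpt p).trans ?_
  rw [Finset.sum_add_distrib, ← Finset.mul_sum, ← Finset.mul_sum]
  -- incidence: the two far bonds of each plaquette, counted over all plaquettes, are at most `4d` copies of every bond
  have hinc : ∑ p : Plaq P i, (‖Z ⟨p.src.shift p.ν, p.μ⟩‖ ^ 2 + ‖Z ⟨p.src, p.ν⟩‖ ^ 2) ≤ 4 * P.d * ∑ b : PBond P i, ‖Z b‖ ^ 2 := by
    have h := sum_plaq_bonds_le (P := P) (j := i) (fun b => ‖Z b‖ ^ 2) (fun b => by positivity)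
    refine (Finset.sum_le_sum fun p _ => ?_).trans h
    nlinarith [sq_nonneg ‖Z ⟨p.src, p.μ⟩‖, sq_nonneg ‖Z ⟨p.src.shift p.μ, p.ν⟩‖]
  have ha2 : 0 ≤ 16 * a ^ 2 := by positivity
  nlinarith [mul_le_mul_of_nonneg_left hinc ha2]

end Comparison

/-! ## §3 The (SLOT) row at `Δx := Δ^η` -/

section Slot

variable {F : T3Family} {n K : ℕ} {c₀ : ℝ}

/-- `‖frobEquiv⁻¹ M‖² ≤ 2·‖M‖²` (op-norm on `M₂(ℂ)`). [cite: Balaban1985Averaging, (20) p.21] -/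
theorem norm_sq_frobEquiv_symm_le (M : Matrix (Fin 2) (Fin 2) ℂ) : ‖(frobEquiv.symm M : W₂)‖ ^ 2 ≤ 2 * ‖M‖ ^ 2 := by
  rw [norm_sq_frobEquiv_symm]
  exact sum_norm_sq_le_two_mul_opNorm_sq M

/-- The curl of `I • X` has the same norm as the curl of `X`. [folklore] -/
theorem norm_curl_I_smul (W : GaugeField (F.P K) 0 (Matrix.specialUnitaryGroup (Fin 2) ℂ)) (X : PBond (F.P K) 0 → Matrix (Fin 2) (Fin 2) ℂ)
    (μ ν : Fin (F.P K).d) (x : Site (F.P K) 0) :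
    ‖curl (torusT (F.P K) 0) (fun κ z => bgUnits F K W ⟨z, κ⟩) (fun κ z => (I • X) ⟨z, κ⟩) μ ν x‖
      = ‖curl (torusT (F.P K) 0) (fun κ z => bgUnits F K W ⟨z, κ⟩) (formComp X) μ ν x‖ := by
  rw [show (fun κ z => (I • X) ⟨z, κ⟩) = I • formComp X from rfl, curl_smul, norm_smul, Complex.norm_I, one_mul]

/-- ★★★ **THE (SLOT) ROW AT `Δx := Δ^η`, NATURAL CONSTANTS.**  On `RegPr F n K e W` (plaquette window `‖W(∂p) − 1‖ ≤ e·η²`), for every one-form `X` whose curvature pairing obeys the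
L²-form bound `re Σ_b tr(X(b)ᴴ·(Δ′₁X)(b)) ≤ θ′·Σ_b‖X b‖²` ([Balaban1985Variational] p.299 «Δ′ is a local, bounded operator», displayed in its supplier's currency):
`re⟪toL2 X, Δ^η_W (toL2 X)⟫ ≤ 4·c₀·η⁻²·Σ_p ‖K^W_p(I•X)‖² + c₀·η⁻²·(384·regThreshold² + θ′)·Σ_b‖X b‖²`, with the door's plaquette letter `K^W_p`.
[cite: Balaban1985BackgroundPropagators, (3.10) p.392; Balaban1985Variational, (19) p.281, (47)-(48) pp.285-286, p.299] -/
theorem re_inner_DeltaEta_le_of_deltaPrime_form [Fact (0 < c₀)] {e : ℝ} (W : GaugeField (F.P K) 0 (Matrix.specialUnitaryGroup (Fin 2) ℂ)) (hreg : RegPr F n K e W)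
    (X : PBond (F.P K) 0 → Matrix (Fin 2) (Fin 2) ℂ) {θ' : ℝ}
    (hΔ' : RCLike.re (∑ b : PBond (F.P K) 0, Matrix.trace ((X b).conjTranspose
              * deltaPrimeOp (torusT (F.P K) 0) (fun μ x => bgUnits F K W ⟨x, μ⟩) 1 (formComp X) b.dir b.src))
            ≤ θ' * ∑ b : PBond (F.P K) 0, ‖X b‖ ^ 2) :
    RCLike.re ⟪toL2 F K c₀ X, DeltaEta F n K c₀ W (toL2 F K c₀ X)⟫_ℂ
      ≤ 4 * c₀ * (eta F n K)⁻¹ ^ 2 * ∑ p : Plaq (F.P K) 0, ‖((I • X) ⟨p.src, p.μ⟩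
          + ((W ⟨p.src, p.μ⟩ : Matrix (Fin 2) (Fin 2) ℂ) * (I • X) ⟨p.src.shift p.μ, p.ν⟩ * star (W ⟨p.src, p.μ⟩ : Matrix (Fin 2) (Fin 2) ℂ))
          - (((W ⟨p.src, p.μ⟩ * W ⟨p.src.shift p.μ, p.ν⟩ * (W ⟨p.src.shift p.ν, p.μ⟩)⁻¹ : Matrix.specialUnitaryGroup (Fin 2) ℂ) : Matrix (Fin 2) (Fin 2) ℂ)
              * (I • X) ⟨p.src.shift p.ν, p.μ⟩
              * star ((W ⟨p.src, p.μ⟩ * W ⟨p.src.shift p.μ, p.ν⟩ * (W ⟨p.src.shift p.ν, p.μ⟩)⁻¹ : Matrix.specialUnitaryGroup (Fin 2) ℂ) : Matrix (Fin 2) (Fin 2) ℂ))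
          - (((GaugeField.plaqHol W p : Matrix.specialUnitaryGroup (Fin 2) ℂ) : Matrix (Fin 2) (Fin 2) ℂ) * (I • X) ⟨p.src, p.ν⟩
              * star ((GaugeField.plaqHol W p : Matrix.specialUnitaryGroup (Fin 2) ℂ) : Matrix (Fin 2) (Fin 2) ℂ)))‖ ^ 2
        + c₀ * (eta F n K)⁻¹ ^ 2 * (384 * (regThreshold F n K e) ^ 2 + θ') * ∑ b : PBond (F.P K) 0, ‖X b‖ ^ 2 := by
  have hc₀ : 0 < c₀ := Fact.out
  have hη : 0 < (eta F n K)⁻¹ ^ 2 := by have := eta_pos F n K; positivity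
  -- the plaquette window of `RegPr`
  have hUa : ∀ p : Plaq (F.P K) 0, dist1 (GaugeField.plaqHol W p) ≤ regThreshold F n K e := fun p => (hreg.plaqSmall p).le
  -- (i) the reading of `re⟪X̃, Δ^η X̃⟫`
  rw [re_inner_toL2_DeltaEta_eq]
  -- (ii) Frobenius ≤ √2 · op, (iii) curl ≤ K + O(a) (applied to `I • X`)
  have hDD : ∑ p : Plaq (F.P K) 0, ‖(frobEquiv.symm
            (curl (torusT (F.P K) 0) (fun μ x => bgUnits F K W ⟨x, μ⟩) (formComp X) p.μ p.ν p.src) : W₂)‖ ^ 2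
      ≤ 2 * ∑ p : Plaq (F.P K) 0, ‖curl (torusT (F.P K) 0) (fun κ z => unitsField (toUField W) ⟨z, κ⟩) (fun κ z => (I • X) ⟨z, κ⟩) p.μ p.ν p.src‖ ^ 2 := by
    rw [Finset.mul_sum]
    refine Finset.sum_le_sum fun p _ => ?_
    rw [show (fun κ z => unitsField (toUField W) ⟨z, κ⟩) = (fun κ z => bgUnits F K W ⟨z, κ⟩) from rfl, norm_curl_I_smul]
    exact norm_sq_frobEquiv_symm_le _
  have hK := sum_normSq_curl_le_plaqK W hUa (I • X)
  have hd : ((F.P K).d : ℝ) = 3 := by rw [T3Family.P_d]; norm_num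
  rw [hd] at hK
  have hIX : ∑ b : PBond (F.P K) 0, ‖(I • X) b‖ ^ 2 = ∑ b : PBond (F.P K) 0, ‖X b‖ ^ 2 :=
    Finset.sum_congr rfl fun b _ => by rw [Pi.smul_apply, norm_smul, Complex.norm_I, one_mul]
  rw [hIX] at hK
  have hcη : 0 ≤ c₀ * (eta F n K)⁻¹ ^ 2 := by positivity
  -- assemble: `Σ‖frob curl‖² ≤ 4ΣK + 384δ²M`, then multiply by `c₀η⁻²`
  have hF := hDD.trans (mul_le_mul_of_nonneg_left hK zero_le_two)
  have h1 := mul_le_mul_of_nonneg_left hF hcη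
  have h2 := mul_le_mul_of_nonneg_left hΔ' hcη
  linarith [h1, h2]

/-- ★★★ **THE (SLOT) ROW IN THE DOOR'S LETTER** (✓`Prop7HcoWOfSigmaRowsSlots.hcoW_of_sigmaRowsW_slots`, conjunct (SLOT), at `Δx F K W := DeltaEtaSlot F n K c₀ W`, `X := eta • A`): on
`RegPr F n K e W` with `0 < e`, for every one-form `X` with the curvature-part form bound `re Σ_b tr(X(b)ᴴ·(Δ′₁X)(b)) ≤ θ′·Σ_b‖X b‖²`, there are reals `cK cE` with
`re⟪toL2 X, Δx W (toL2 X)⟫ ≤ cK·Σ_p ‖K^W_p(I•X)‖² + cE·e·((L^{K−n})²)⁻¹·Σ_b‖X b‖²` — per-member constants `cK = 4c₀η⁻²`, `cE = c₀η⁻²(384·regThreshold² + θ′)∕(e·η²)`.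
[cite: Balaban1985BackgroundPropagators, (3.10) p.392, (3.26) p.395; Balaban1985Variational, (141)-(143) p.299] -/
theorem slot_DeltaEtaSlot_of_deltaPrime_form [Fact (0 < c₀)] {e : ℝ} (he : 0 < e) (W : GaugeField (F.P K) 0 (Matrix.specialUnitaryGroup (Fin 2) ℂ))
    (hreg : RegPr F n K e W) (X : PBond (F.P K) 0 → Matrix (Fin 2) (Fin 2) ℂ) {θ' : ℝ}
    (hΔ' : RCLike.re (∑ b : PBond (F.P K) 0, Matrix.trace ((X b).conjTranspose
              * deltaPrimeOp (torusT (F.P K) 0) (fun μ x => bgUnits F K W ⟨x, μ⟩) 1 (formComp X) b.dir b.src))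
            ≤ θ' * ∑ b : PBond (F.P K) 0, ‖X b‖ ^ 2) :
    ∃ cK cE : ℝ, 0 ≤ cK ∧
      RCLike.re ⟪toL2 F K c₀ X, (DeltaEtaSlot F n K c₀) W (toL2 F K c₀ X)⟫_ℂ
        ≤ cK * (∑ p : Plaq (F.P K) 0, ‖((I • X) ⟨p.src, p.μ⟩
          + ((W ⟨p.src, p.μ⟩ : Matrix (Fin 2) (Fin 2) ℂ) * (I • X) ⟨p.src.shift p.μ, p.ν⟩ * star (W ⟨p.src, p.μ⟩ : Matrix (Fin 2) (Fin 2) ℂ))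
          - (((W ⟨p.src, p.μ⟩ * W ⟨p.src.shift p.μ, p.ν⟩ * (W ⟨p.src.shift p.ν, p.μ⟩)⁻¹ : Matrix.specialUnitaryGroup (Fin 2) ℂ) : Matrix (Fin 2) (Fin 2) ℂ)
              * (I • X) ⟨p.src.shift p.ν, p.μ⟩
              * star ((W ⟨p.src, p.μ⟩ * W ⟨p.src.shift p.μ, p.ν⟩ * (W ⟨p.src.shift p.ν, p.μ⟩)⁻¹ : Matrix.specialUnitaryGroup (Fin 2) ℂ) : Matrix (Fin 2) (Fin 2) ℂ))
          - (((GaugeField.plaqHol W p : Matrix.specialUnitaryGroup (Fin 2) ℂ) : Matrix (Fin 2) (Fin 2) ℂ) * (I • X) ⟨p.src, p.ν⟩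
              * star ((GaugeField.plaqHol W p : Matrix.specialUnitaryGroup (Fin 2) ℂ) : Matrix (Fin 2) (Fin 2) ℂ)))‖ ^ 2)
          + cE * e * (((F.L : ℝ) ^ (K - n)) ^ 2)⁻¹ * (∑ b : PBond (F.P K) 0, ‖X b‖ ^ 2) := by
  have hc₀ : 0 < c₀ := Fact.out
  have hη : 0 < eta F n K := eta_pos F n K
  have hL : ((((F.L : ℝ) ^ (K - n)) ^ 2)⁻¹ : ℝ) = eta F n K ^ 2 := by
    rw [eta, inv_pow, ← inv_pow]
  refine ⟨4 * c₀ * (eta F n K)⁻¹ ^ 2, c₀ * (eta F n K)⁻¹ ^ 2 * (384 * (regThreshold F n K e) ^ 2 + θ') * (e * eta F n K ^ 2)⁻¹, by positivity, ?_⟩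
  rw [DeltaEtaSlot_apply, hL]
  have h := re_inner_DeltaEta_le_of_deltaPrime_form (c₀ := c₀) W hreg X hΔ'
  have hcancel : c₀ * (eta F n K)⁻¹ ^ 2 * (384 * (regThreshold F n K e) ^ 2 + θ') * (e * eta F n K ^ 2)⁻¹ * e * eta F n K ^ 2
      = c₀ * (eta F n K)⁻¹ ^ 2 * (384 * (regThreshold F n K e) ^ 2 + θ') := by
    field_simp
  rw [hcancel]
  exact h

/-! ## §4 (v1.1) The (SLOT) row on `RegPr`, UNCONDITIONAL — the curvature part from ★w4 g8's ✓`Prop7DeltaPrimeL2Bound` -/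

/-- ★ **THE CURVATURE PART OF (3.10) IN THE ROUTE'S TRACE PAIRING IS `O(e·η²)` IN L²-FORM** (op-norm mass): on `RegPr F n K e W`, `0 ≤ e`,
`re Σ_b tr(X(b)ᴴ·(Δ′₁X)(b)) ≤ 2058·(e·η²)·Σ_b ‖X b‖²` — ✓`Prop7DeltaPrimeL2Bound.norm_sum_trace_conjTranspose_mul_deltaPrimeOp_le` (constant `1029`, Frobenius mass) read through
`re z ≤ ‖z‖` and `‖frobEquiv⁻¹ M‖² ≤ 2‖M‖²`. [cite: Balaban1985BackgroundPropagators, (3.10) p.392, (3.69) p.404; Balaban1985Variational, p.299] -/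
theorem re_sum_trace_deltaPrimeOp_le_of_regPr {e : ℝ} (he : 0 ≤ e) (W : GaugeField (F.P K) 0 (Matrix.specialUnitaryGroup (Fin 2) ℂ)) (hreg : RegPr F n K e W)
    (X : PBond (F.P K) 0 → Matrix (Fin 2) (Fin 2) ℂ) :
    RCLike.re (∑ b : PBond (F.P K) 0, Matrix.trace ((X b).conjTranspose
        * deltaPrimeOp (torusT (F.P K) 0) (fun μ x => bgUnits F K W ⟨x, μ⟩) 1 (formComp X) b.dir b.src))
      ≤ 2058 * (e * eta F n K ^ 2) * ∑ b : PBond (F.P K) 0, ‖X b‖ ^ 2 := by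
  have h := Prop7DeltaPrimeL2Bound.norm_sum_trace_conjTranspose_mul_deltaPrimeOp_le he W hreg X
  have hfrob : ∑ b : PBond (F.P K) 0, ‖(frobEquiv.symm (X b) : W₂)‖ ^ 2 ≤ 2 * ∑ b : PBond (F.P K) 0, ‖X b‖ ^ 2 := by
    rw [Finset.mul_sum]
    exact Finset.sum_le_sum fun b _ => norm_sq_frobEquiv_symm_le (X b)
  have hδ : 0 ≤ 1029 * (e * eta F n K ^ 2) := by positivity
  calc RCLike.re (∑ b : PBond (F.P K) 0, Matrix.trace ((X b).conjTranspose
          * deltaPrimeOp (torusT (F.P K) 0) (fun μ x => bgUnits F K W ⟨x, μ⟩) 1 (formComp X) b.dir b.src))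
      ≤ ‖∑ b : PBond (F.P K) 0, Matrix.trace ((X b).conjTranspose
          * deltaPrimeOp (torusT (F.P K) 0) (fun μ x => bgUnits F K W ⟨x, μ⟩) 1 (formComp X) b.dir b.src)‖ := RCLike.re_le_norm _
    _ ≤ 1029 * (e * eta F n K ^ 2) * ∑ b : PBond (F.P K) 0, ‖(frobEquiv.symm (X b) : W₂)‖ ^ 2 := h
    _ ≤ 1029 * (e * eta F n K ^ 2) * (2 * ∑ b : PBond (F.P K) 0, ‖X b‖ ^ 2) := mul_le_mul_of_nonneg_left hfrob hδ
    _ = 2058 * (e * eta F n K ^ 2) * ∑ b : PBond (F.P K) 0, ‖X b‖ ^ 2 := by ring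

/-- ★★★ **THE (SLOT) ROW AT `Δx := Δ^η` ON `RegPr`, NATURAL CONSTANTS, NO DISPLAYED HYPOTHESIS**: on `RegPr F n K e W` (`0 ≤ e`), for EVERY one-form `X`,
`re⟪toL2 X, Δ^η_W (toL2 X)⟫ ≤ 4·c₀·η⁻²·Σ_p ‖K^W_p(I•X)‖² + c₀·η⁻²·(384·regThreshold² + 2058·e·η²)·Σ_b‖X b‖²` (= ✓`re_inner_DeltaEta_le_of_deltaPrime_form` ∘
✓`re_sum_trace_deltaPrimeOp_le_of_regPr`; since `regThreshold = e·η²`, the mass coefficient is `c₀·e·(2058 + 384·e·η²)` — L-only × `e` up to the vanishing `e·η²`).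
[cite: Balaban1985BackgroundPropagators, (3.10) p.392; Balaban1985Variational, (19) p.281, (47)-(48) pp.285-286, p.299] -/
theorem re_inner_DeltaEta_le_of_regPr [Fact (0 < c₀)] {e : ℝ} (he : 0 ≤ e) (W : GaugeField (F.P K) 0 (Matrix.specialUnitaryGroup (Fin 2) ℂ)) (hreg : RegPr F n K e W)
    (X : PBond (F.P K) 0 → Matrix (Fin 2) (Fin 2) ℂ) :
    RCLike.re ⟪toL2 F K c₀ X, DeltaEta F n K c₀ W (toL2 F K c₀ X)⟫_ℂ
      ≤ 4 * c₀ * (eta F n K)⁻¹ ^ 2 * ∑ p : Plaq (F.P K) 0, ‖((I • X) ⟨p.src, p.μ⟩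
          + ((W ⟨p.src, p.μ⟩ : Matrix (Fin 2) (Fin 2) ℂ) * (I • X) ⟨p.src.shift p.μ, p.ν⟩ * star (W ⟨p.src, p.μ⟩ : Matrix (Fin 2) (Fin 2) ℂ))
          - (((W ⟨p.src, p.μ⟩ * W ⟨p.src.shift p.μ, p.ν⟩ * (W ⟨p.src.shift p.ν, p.μ⟩)⁻¹ : Matrix.specialUnitaryGroup (Fin 2) ℂ) : Matrix (Fin 2) (Fin 2) ℂ)
              * (I • X) ⟨p.src.shift p.ν, p.μ⟩
              * star ((W ⟨p.src, p.μ⟩ * W ⟨p.src.shift p.μ, p.ν⟩ * (W ⟨p.src.shift p.ν, p.μ⟩)⁻¹ : Matrix.specialUnitaryGroup (Fin 2) ℂ) : Matrix (Fin 2) (Fin 2) ℂ))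
          - (((GaugeField.plaqHol W p : Matrix.specialUnitaryGroup (Fin 2) ℂ) : Matrix (Fin 2) (Fin 2) ℂ) * (I • X) ⟨p.src, p.ν⟩
              * star ((GaugeField.plaqHol W p : Matrix.specialUnitaryGroup (Fin 2) ℂ) : Matrix (Fin 2) (Fin 2) ℂ)))‖ ^ 2
        + c₀ * (eta F n K)⁻¹ ^ 2 * (384 * (regThreshold F n K e) ^ 2 + 2058 * (e * eta F n K ^ 2)) * ∑ b : PBond (F.P K) 0, ‖X b‖ ^ 2 :=
  re_inner_DeltaEta_le_of_deltaPrime_form W hreg X (re_sum_trace_deltaPrimeOp_le_of_regPr he W hreg X)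

/-- ★★★ **THE (SLOT) ROW IN THE DOOR'S LETTER ON `RegPr`, UNCONDITIONAL** (✓`Prop7HcoWOfSigmaRowsSlots.hcoW_of_sigmaRowsW_slots`, conjunct (SLOT), at `Δx F K W := DeltaEtaSlot F n K c₀ W`,
`X := eta • A`): for `0 < e` and `RegPr F n K e W`, every one-form `X` admits reals `cK cE` (`cK = 4c₀η⁻²`, `cE = c₀η⁻²(384·regThreshold² + 2058·e·η²)∕(e·η²)`, so that
`(cE·e)·η² = c₀·e·(2058 + 384·e·η²)`) with `re⟪toL2 X, Δx W (toL2 X)⟫ ≤ cK·Σ_p ‖K^W_p(I•X)‖² + cE·e·((L^{K−n})²)⁻¹·Σ_b‖X b‖²`.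
[cite: Balaban1985BackgroundPropagators, (3.10) p.392, (3.26) p.395; Balaban1985Variational, (141)-(143) p.299] -/
theorem slot_DeltaEtaSlot_of_regPr [Fact (0 < c₀)] {e : ℝ} (he : 0 < e) (W : GaugeField (F.P K) 0 (Matrix.specialUnitaryGroup (Fin 2) ℂ))
    (hreg : RegPr F n K e W) (X : PBond (F.P K) 0 → Matrix (Fin 2) (Fin 2) ℂ) :
    ∃ cK cE : ℝ, 0 ≤ cK ∧
      RCLike.re ⟪toL2 F K c₀ X, (DeltaEtaSlot F n K c₀) W (toL2 F K c₀ X)⟫_ℂ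
        ≤ cK * (∑ p : Plaq (F.P K) 0, ‖((I • X) ⟨p.src, p.μ⟩
          + ((W ⟨p.src, p.μ⟩ : Matrix (Fin 2) (Fin 2) ℂ) * (I • X) ⟨p.src.shift p.μ, p.ν⟩ * star (W ⟨p.src, p.μ⟩ : Matrix (Fin 2) (Fin 2) ℂ))
          - (((W ⟨p.src, p.μ⟩ * W ⟨p.src.shift p.μ, p.ν⟩ * (W ⟨p.src.shift p.ν, p.μ⟩)⁻¹ : Matrix.specialUnitaryGroup (Fin 2) ℂ) : Matrix (Fin 2) (Fin 2) ℂ)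
              * (I • X) ⟨p.src.shift p.ν, p.μ⟩
              * star ((W ⟨p.src, p.μ⟩ * W ⟨p.src.shift p.μ, p.ν⟩ * (W ⟨p.src.shift p.ν, p.μ⟩)⁻¹ : Matrix.specialUnitaryGroup (Fin 2) ℂ) : Matrix (Fin 2) (Fin 2) ℂ))
          - (((GaugeField.plaqHol W p : Matrix.specialUnitaryGroup (Fin 2) ℂ) : Matrix (Fin 2) (Fin 2) ℂ) * (I • X) ⟨p.src, p.ν⟩
              * star ((GaugeField.plaqHol W p : Matrix.specialUnitaryGroup (Fin 2) ℂ) : Matrix (Fin 2) (Fin 2) ℂ)))‖ ^ 2)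
          + cE * e * (((F.L : ℝ) ^ (K - n)) ^ 2)⁻¹ * (∑ b : PBond (F.P K) 0, ‖X b‖ ^ 2) :=
  slot_DeltaEtaSlot_of_deltaPrime_form he W hreg X (re_sum_trace_deltaPrimeOp_le_of_regPr he.le W hreg X)

end Slot

end Summit.QuantumFields.YangMills.Theorems.Prop7SlotRowOfDeltaEta

end
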